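import Summits.NavierStokesRegularity.NavierStokesRegularity.Theses.HodographBetchov
import Summits.NavierStokesRegularity.NavierStokesRegularity.Theorems.HodographBetchovSlowClassProductionDeepVorticity
import Literature.Analysis.FluidPDE.NSCriticalClosureBesovKatoClass
import Literature.Analysis.FluidPDE.KatoFarFieldBound

/-!
# `SlowClassProduction` (stmt-NavierStokesRegularity-15831), line `near_field` — stub 2 `stub_farFieldVelocity`

Route `HodographBetchov`, crux 2, planner skeleton `Cruxes/SlowClassProduction/Lines/near_field.lean`.
**Far-field velocity bound up to the final time**: for a classical Navier–Stokes solution on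
`ℝ³ × [0,T)` that is Leray–Hopf from a rapidly decaying datum there are a layer thickness
`h ∈ (0,T)`, a radius `R` and a bound `L` with `‖u(t,x)‖ ≤ L` for all `T − h ≤ t < T`, `‖x‖ ≥ R`.

Proof (all inputs are theorems of the tree).  The classical Leray–Hopf solution is a Kato
`C_t L³` solution on `[0,T)` (`isKatoSolutionOn_of_classical`, Lemarié-Rieusset 2016 Thm. 15.1
(A)–(B)); Kato solutions are essentially bounded on a far-field final layer
`(T − δ, T) × {‖x‖ > R}` (`IsKatoSolutionOn.farField_bound_holds`: restart at a bounded slice,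
CKN ε-regularity in the far field — Rusin–Šverák 2011 §4, Lemarié-Rieusset 2016 proof of
Thm. 15.1 (C)); `u` is jointly continuous on `[0,T) × ℝ³`, so the essential bound holds at every
point of the open layer (`forall_le_of_ae_restrict_le`), and shrinking the layer to the half-closed
window `[T − h, T) × {‖x‖ ≥ R + 1}` gives the stub as stated.
-/

noncomputable section

-- the summit and its single problem share the name `NavierStokesRegularity` (D-0017 nested layout)
set_option linter.dupNamespace false

namespace Summit.NavierStokesRegularity.NavierStokesRegularity.Theorems.SlowClassProduction.NearField

open Set MeasureTheory Function Metric Filter Topology Literature.Analysis.FluidPDE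
open scoped ENNReal NNReal

/-- **Stub `stub_farFieldVelocity` of line `near_field` for the crux `SlowClassProduction`
(stmt-NavierStokesRegularity-15831): far-field velocity bound up to the final time.**  For
`ν, T > 0` and a classical solution `(u, p)` of the unforced Navier–Stokes system on `ℝ³ × [0,T)`
which is Leray–Hopf on `[0,T]` from its rapidly decaying datum, there are `h ∈ (0,T)`, `R` and `L`
with `‖u(t,x)‖ ≤ L` whenever `T − h ≤ t < T` and `R ≤ ‖x‖`.  Proof: `u` is a Kato solution on
`[0,T)` (`isKatoSolutionOn_of_classical`); the far-field bound of Kato solutions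
(`IsKatoSolutionOn.farField_bound_holds`) gives `δ > 0`, `R₀` with `u` essentially bounded on
`(T − δ, T) × B̄(0,R₀)ᶜ`; on the open sub-layer `(T − δ', T) × B̄(0,R₀)ᶜ`, `δ' = min δ T`, the
velocity is continuous, so the bound is pointwise (`forall_le_of_ae_restrict_le`); take
`h = δ'/2`, `R = R₀ + 1`. [cite: RusinSverak2011, §4 p. 6] [cite: LemarieRieusset2016, Thm. 15.1 (C), proof p. 566] -/
theorem stub_farFieldVelocity :
    ∀ (ν T : ℝ), 0 < ν → 0 < T →
      ∀ (u : ℝ → EuclideanSpace ℝ (Fin 3) → EuclideanSpace ℝ (Fin 3))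
        (p : ℝ → EuclideanSpace ℝ (Fin 3) → ℝ),
        Literature.Analysis.FluidPDE.IsClassicalNSSolutionOn (Set.Ico 0 T) ν 0 u p →
        Literature.Analysis.FluidPDE.IsLerayHopfOn T ν 0 (u 0) u →
        Literature.Analysis.FluidPDE.HasRapidSpatialDecay (u 0) →
        ∃ h : ℝ, 0 < h ∧ h < T ∧ ∃ R L : ℝ, ∀ t ∈ Set.Ico (T - h) T,
          ∀ x : EuclideanSpace ℝ (Fin 3), R ≤ ‖x‖ → ‖u t x‖ ≤ L := by
  intro ν T hν hT u p hcl hLH hdec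
  -- `u` is a Kato solution on `[0,T)`, hence essentially bounded on a far-field final layer
  have hK : IsKatoSolutionOn T ν (u 0) u := isKatoSolutionOn_of_classical hν hT hcl hLH hdec
  obtain ⟨δ, hδ, R₀, hfar⟩ := IsKatoSolutionOn.farField_bound_holds hν hT hK
  -- the essential bound as an a.e. pointwise bound with a real constant
  set S : Set (ℝ × EuclideanSpace ℝ (Fin 3)) :=
    Ioo (T - δ) T ×ˢ (closedBall (0 : EuclideanSpace ℝ (Fin 3)) R₀)ᶜ with hS_def
  set M : ℝ := (eLpNorm (uncurry u) ∞ (volume.restrict S)).toReal with hM_def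
  have hMeq : eLpNorm (uncurry u) ∞ (volume.restrict S) = ENNReal.ofReal M := by
    rw [hM_def, ENNReal.ofReal_toReal hfar.ne]
  have hae : ∀ᵐ z ∂(volume.restrict S), ‖uncurry u z‖ ≤ M := by
    have h1 : ∀ᵐ z ∂(volume.restrict S), ‖uncurry u z‖ₑ ≤ ENNReal.ofReal M := by
      refine (ae_le_eLpNormEssSup (f := uncurry u)).mono fun z hz => hz.trans ?_
      rw [← eLpNorm_exponent_top, hMeq]
    filter_upwards [h1] with z hz
    rw [← ofReal_norm] at hz
    exact (ENNReal.ofReal_le_ofReal_iff ENNReal.toReal_nonneg).1 hz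
  -- the open sub-layer inside `[0,T) × ℝ³`
  set δ' : ℝ := min δ T with hδ'_def
  have hδ'0 : 0 < δ' := lt_min hδ hT
  have hδ'δ : δ' ≤ δ := min_le_left _ _
  have hδ'T : δ' ≤ T := min_le_right _ _
  set O : Set (ℝ × EuclideanSpace ℝ (Fin 3)) :=
    Ioo (T - δ') T ×ˢ (closedBall (0 : EuclideanSpace ℝ (Fin 3)) R₀)ᶜ with hO_def
  have hO : IsOpen O := isOpen_Ioo.prod isClosed_closedBall.isOpen_compl
  have hOS : O ⊆ S := prod_mono (Ioo_subset_Ioo (by linarith) le_rfl) Subset.rfl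
  have hOslab : O ⊆ Ico 0 T ×ˢ (univ : Set (EuclideanSpace ℝ (Fin 3))) :=
    prod_mono (fun s hs => ⟨by linarith [hs.1], hs.2⟩) (subset_univ _)
  have hcont : ContinuousOn (fun z : ℝ × EuclideanSpace ℝ (Fin 3) => ‖uncurry u z‖) O :=
    (hcl.smooth_velocity.continuousOn.mono hOslab).norm
  have haeO : ∀ᵐ z ∂(volume.restrict O), ‖uncurry u z‖ ≤ M :=
    ae_restrict_of_ae_restrict_of_subset hOS hae
  have hptw : ∀ z ∈ O, ‖uncurry u z‖ ≤ M :=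
    Birth.forall_le_of_ae_restrict_le hO hcont haeO
  -- the half-closed window `[T - δ'/2, T) × {R₀ + 1 ≤ ‖x‖}` lies in `O`
  refine ⟨δ' / 2, by positivity, by linarith, R₀ + 1, M, fun t ht x hx => ?_⟩
  have hmem : ((t, x) : ℝ × EuclideanSpace ℝ (Fin 3)) ∈ O := by
    refine mk_mem_prod ⟨by linarith [ht.1], ht.2⟩ ?_
    rw [mem_compl_iff, mem_closedBall, dist_zero_right, not_le]
    linarith
  exact hptw (t, x) hmem

end Summit.NavierStokesRegularity.NavierStokesRegularity.Theorems.SlowClassProduction.NearField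

end
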